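import Summits.CriticalPhenomena.CardyFormulaZ2.Theorems.CardyIKTransportCornerLineDescentLine
import Summits.CriticalPhenomena.CardyFormulaZ2.Theorems.CardyIKTransportCornerLineDescentLocality
import Literature.Probability.Percolation.SitePercolationMeasure
import Literature.Probability.Percolation.TriHexLemma

/-!
# Stub `stub_DiluteInfluence` (line `symmetric-seed-second-order`, crux `CardyIKTransport.CornerLineDescent`,
# stmt-CriticalPhenomena-10964), groundwork part 1: the STRUCTURAL ZEROS of the single-syndrome influence

Over the vocabulary `Theorems/CardyIKTransportCornerLineDescentLine.lean`, for every density `p`, mesh `δ` and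
conformal rectangle `R`: the crude event reads only the black edges inside the lattice window `window R δ`, which
read only the window colours and the coins (§A; cf. the box version `mem_gaugeEdges_congr` of `…Locality.lean`);
forcing the syndrome at `f` ON rather than OFF recolours exactly `quadrant f = farSide f₀ × farSide f₁` (§B); the
gauge flip `(A, B) ↦ (A ∆ H₀, B ∆ H₁)` of the fair column/row bits preserves `gaugeMeasure p` and recolours `v` iff
`[v₀ ∈ H₀] ⊕ [v₁ ∈ H₁]` (§C); hence (§D) `influence_eq_zero_of_quadrant_iff` (registered anchor form:
`influence_eq_zero_of_plaid`) — if on the window the quadrant of `f` is such a plaid set then `I_f(p) = 0` EXACTLY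
(law level: rays are pure gauge) — with corollaries `influence_eq_zero_of_row` / `_of_col`, the support bound
`support_influence_subset : support (influence p R δ) ⊆ splittingFaces R δ` and `influenceSum_eq_finsum_splittingFaces`.
Part 2 (`…DiluteInfluenceReduction.lean`) counts the splitting faces and reduces the stub to a signed
single-dislocation estimate, which stays OPEN.
-/

noncomputable section

namespace Summit.CriticalPhenomena.CardyFormulaZ2.Theorems.CornerLineDescent.SymmetricSeed

open scoped BigOperators Topology Classical MeasureTheory ProbabilityTheory ENNReal NNReal symmDiff
open Filter Set Function MeasureTheory
open Literature.Probability.Percolation (sitePercolation bondPercolation half BondConfig embDomainCrossing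
  rectangle openGraph openConnIn sitePi bernoulliProp)
open Literature.Probability.LatticeModels
open Literature.Probability.RandomPlanarGeometry

/-! ## §A The crude event reads only the window edges -/

/-- The lattice window of `R` at mesh `δ`: the cells `y` with `δ (y₀ + i y₁) ∈ R.carrier` (verbatim the
vertex set `S` of `embDomainCrossing` inside `crossingEvent R δ`). [folklore] -/
def window (R : ConformalRectangle) (δ : ℝ) : Set (Site 2) :=
  {y | (δ : ℂ) * (((y 0 : ℝ) : ℂ) + ((y 1 : ℝ) : ℂ) * Complex.I) ∈ R.carrier}

/-- A restricted connection event `{x ↔ y in S}` reads only the edges with both endpoints in `S`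
(Grimmett 1999, §1.3: it is a property of the open graph induced on `S`). [folklore] -/
theorem openConnIn_congr_of_edges {V : Type*} {S : Set V} {E E' : BondConfig V}
    (h : ∀ u ∈ S, ∀ v ∈ S, (s(u, v) ∈ E ↔ s(u, v) ∈ E')) (x y : V) :
    E ∈ openConnIn S x y ↔ E' ∈ openConnIn S x y := by
  have hG : (openGraph E).induce S = (openGraph E').induce S := by
    ext a b
    simp only [SimpleGraph.induce_adj, Literature.Probability.Percolation.openGraph_adj]
    rw [h a a.2 b b.2]
  simp only [openConnIn, Set.mem_setOf_eq, hG]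

/-- The crude crossing event reads only the black edges with both endpoints in the window. [folklore] -/
theorem mem_crossingEvent_congr_of_edges {R : ConformalRectangle} {δ : ℝ} {ω ω' : Bits}
    (h : ∀ u ∈ window R δ, ∀ v ∈ window R δ,
      (s(u, v) ∈ gaugeEdges ω ↔ s(u, v) ∈ gaugeEdges ω')) :
    ω ∈ crossingEvent R δ ↔ ω' ∈ crossingEvent R δ := by
  simp only [crossingEvent, Set.mem_setOf_eq,
    Literature.Probability.Percolation.mem_embDomainCrossing_iff]
  exact exists_congr fun u => and_congr_right fun _ => exists_congr fun v =>
    and_congr_right fun _ => openConnIn_congr_of_edges h u v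

/-- One direction of `mem_gaugeEdges_congr_of_colour`. [folklore] -/
theorem mem_gaugeEdges_of_colour {W : Set (Site 2)} {ω ω' : Bits}
    (hc : ∀ v ∈ W, (gaugeColour ω v ↔ gaugeColour ω' v)) (hk : ω.2.2.2.2 = ω'.2.2.2.2)
    {u v : Site 2} (hu : u ∈ W) (hv : v ∈ W) (he : s(u, v) ∈ gaugeEdges ω) :
    s(u, v) ∈ gaugeEdges ω' := by
  simp only [gaugeEdges, gaugeCoin, Set.mem_setOf_eq] at he ⊢
  obtain ⟨a, b, hab, ha, hb, hgeom⟩ := he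
  have haW : a ∈ W := by
    rcases Sym2.eq_iff.1 hab with ⟨rfl, rfl⟩ | ⟨rfl, rfl⟩ <;> assumption
  have hbW : b ∈ W := by
    rcases Sym2.eq_iff.1 hab with ⟨rfl, rfl⟩ | ⟨rfl, rfl⟩ <;> assumption
  refine ⟨a, b, hab, (hc a haW).1 ha, (hc b hbW).1 hb, ?_⟩
  rw [← hk]; exact hgeom

/-- The black edges inside `W` are determined by the colours of the cells of `W` and the coins
(an edge `s(u,v)` of `gaugeEdges ω` reads the colours of `u, v` and the coins at `u`, `u + (0,-1)`). [folklore] -/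
theorem mem_gaugeEdges_congr_of_colour {W : Set (Site 2)} {ω ω' : Bits}
    (hc : ∀ v ∈ W, (gaugeColour ω v ↔ gaugeColour ω' v)) (hk : ω.2.2.2.2 = ω'.2.2.2.2) :
    ∀ u ∈ W, ∀ v ∈ W, (s(u, v) ∈ gaugeEdges ω ↔ s(u, v) ∈ gaugeEdges ω') :=
  fun _ hu _ hv => ⟨mem_gaugeEdges_of_colour hc hk hu hv,
    mem_gaugeEdges_of_colour (fun v hv => (hc v hv).symm) hk.symm hu hv⟩

/-! ## §B The colour of a cell: which syndromes it reads -/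

/-- `Xor` bookkeeping: `a ⊕ ⊥ = a`. [folklore] -/
private theorem xor_false_right (a : Prop) : Xor a False ↔ a := by
  unfold Xor; tauto

/-- `Xor` bookkeeping: `a ⊕ (b ⊕ ¬c) = ¬(a ⊕ (b ⊕ c))`. [folklore] -/
private theorem xor_xor_not_right (a b c : Prop) : Xor a (Xor b (¬ c)) ↔ ¬ Xor a (Xor b c) := by
  unfold Xor; by_cases a <;> by_cases b <;> by_cases c <;> simp_all

/-- `Xor` bookkeeping: `(a ⊕ a') ⊕ ((b ⊕ b') ⊕ c) = (a' ⊕ b') ⊕ (a ⊕ (b ⊕ c))`. [folklore] -/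
private theorem xor_flip_aux (a a' b b' c : Prop) :
    Xor (Xor a a') (Xor (Xor b b') c) ↔ Xor (Xor a' b') (Xor a (Xor b c)) := by
  unfold Xor; by_cases a <;> by_cases a' <;> by_cases b <;> by_cases b' <;> by_cases c <;> simp_all

/-- Indicator bookkeeping, uniform in the `Decidable` instances. [folklore] -/
private theorem ite_one_zero_congr {P Q : Prop} (d₁ : Decidable P) (d₂ : Decidable Q) (h : P ↔ Q) :
    @ite ℕ P d₁ 1 0 = @ite ℕ Q d₂ 1 0 := by
  by_cases hq : Q
  · rw [if_pos (h.2 hq), if_pos hq]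
  · rw [if_neg (fun hp => hq (h.1 hp)), if_neg hq]

/-- The syndrome rectangle of the cell `v` (verbatim the index set inside `gaugeColour`): the faces
`g = (g₀, g₁)` with `gᵢ ∈ Ico (min 0 vᵢ) (max 0 vᵢ)`. [folklore] -/
def synRect (v : Site 2) : Finset (ℤ × ℤ) :=
  Finset.Ico (min 0 (v 0)) (max 0 (v 0)) ×ˢ Finset.Ico (min 0 (v 1)) (max 0 (v 1))

/-- The number of syndromes of `D` in the rectangle of `v`. [folklore] -/
def synCount (D : Set (Site 2)) (v : Site 2) : ℕ :=
  (Finset.filter (fun g : ℤ × ℤ => (![g.1, g.2] : Site 2) ∈ D) (synRect v)).card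

/-- The QUADRANT of the face `f`: the cells whose colour reads the syndrome at `f` (the cells `v` with
`f` in the rectangle between `0` and `v`; it points away from the origin). [folklore] -/
def quadrant (f : Site 2) : Set (Site 2) := {v | (f 0, f 1) ∈ synRect v}

/-- `farSide a`: the integers on the far side of `a` from the origin (`0 ≤ a < x` or `x ≤ a < 0`), i.e.
`{x | a ∈ Ico (min 0 x) (max 0 x)}`. [folklore] -/
def farSide (a : ℤ) : Set ℤ := {x | (0 ≤ a ∧ a < x) ∨ (a < 0 ∧ x ≤ a)}

/-- `a ∈ Ico (min 0 x) (max 0 x) ↔ x ∈ farSide a`. [folklore] -/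
theorem mem_Ico_min_max_iff (a x : ℤ) : a ∈ Finset.Ico (min 0 x) (max 0 x) ↔ x ∈ farSide a := by
  simp only [Finset.mem_Ico, min_le_iff, lt_max_iff, farSide, Set.mem_setOf_eq]
  omega

/-- The quadrant of `f` is the product of the two far sides: `v ∈ quadrant f ↔ v₀ ∈ farSide f₀ ∧
v₁ ∈ farSide f₁`. [folklore] -/
theorem mem_quadrant_iff (f v : Site 2) : v ∈ quadrant f ↔ v 0 ∈ farSide (f 0) ∧ v 1 ∈ farSide (f 1) := by
  simp only [quadrant, Set.mem_setOf_eq, synRect, Finset.mem_product, mem_Ico_min_max_iff]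

/-- The colour of `v` unfolded: `A_{v₀} ⊕ B_{v₁} ⊕ parity(synCount D v)`. [folklore] -/
theorem gaugeColour_iff (ω : Bits) (v : Site 2) :
    gaugeColour ω v ↔ Xor (v 0 ∈ ω.1) (Xor (v 1 ∈ ω.2.1) (Odd (synCount ω.2.2.1 v))) := by
  simp only [gaugeColour, synCount, synRect, Set.mem_univ, true_and, not_true_eq_false, false_and,
    or_false]

/-- `![g.1, g.2] = f ↔ g = (f 0, f 1)`. [folklore] -/
theorem vec_eq_iff (g : ℤ × ℤ) (f : Site 2) : (![g.1, g.2] : Site 2) = f ↔ g = (f 0, f 1) := by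
  refine ⟨fun h => Prod.ext (by simpa using congrFun h 0) (by simpa using congrFun h 1), ?_⟩
  rintro rfl
  ext i; fin_cases i <;> rfl

/-- Off the face `f` itself, membership in `insert f D` and in `D \ {f}` agree (indicator form). [folklore] -/
private theorem ite_mem_insert_eq_ite_mem_sdiff {f : Site 2} {D : Set (Site 2)} {g : ℤ × ℤ}
    (hg : g ≠ (f 0, f 1)) (d₁ : Decidable ((![g.1, g.2] : Site 2) ∈ insert f D))
    (d₂ : Decidable ((![g.1, g.2] : Site 2) ∈ D \ {f})) : @ite ℕ _ d₁ 1 0 = @ite ℕ _ d₂ 1 0 := by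
  have hne : (![g.1, g.2] : Site 2) ≠ f := fun h' => hg ((vec_eq_iff g f).1 h')
  exact ite_one_zero_congr _ _ (by
    simp only [Set.mem_insert_iff, hne, false_or, Set.mem_sdiff_singleton, ne_eq, not_false_eq_true,
      and_true])

/-- Forcing the syndrome at `f` ON rather than OFF adds exactly `[v ∈ quadrant f]` to the syndrome
count of `v`. [folklore] -/
theorem synCount_insert_eq (f : Site 2) (D : Set (Site 2)) (v : Site 2) :
    synCount (insert f D) v = synCount (D \ {f}) v + (if v ∈ quadrant f then 1 else 0) := by
  unfold synCount quadrant
  rw [Finset.card_filter, Finset.card_filter, Set.mem_setOf_eq]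
  split_ifs with hf
  · rw [← Finset.add_sum_erase _ _ hf, ← Finset.add_sum_erase _ _ hf]
    have e1 : (![(f 0, f 1).1, (f 0, f 1).2] : Site 2) = f := (vec_eq_iff _ _).2 rfl
    rw [e1, if_pos (Set.mem_insert f D), if_neg (fun h => h.2 rfl), zero_add, add_comm _ 1]
    congr 1
    exact Finset.sum_congr rfl fun g hg =>
      ite_mem_insert_eq_ite_mem_sdiff (Finset.ne_of_mem_erase hg) _ _
  · rw [add_zero]
    exact Finset.sum_congr rfl fun g hg =>
      ite_mem_insert_eq_ite_mem_sdiff (fun h => hf (h ▸ hg)) _ _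

/-- A face whose quadrant misses the cell `v` does not enter its colour. [folklore] -/
theorem gaugeColour_force_iff_of_notMem_quadrant {f v : Site 2} (h : v ∉ quadrant f) (b : Bool)
    (ω : Bits) : gaugeColour (force f b ω) v ↔ gaugeColour ω v := by
  have hg : ∀ g ∈ synRect v, g ≠ (f 0, f 1) := fun g hg h' =>
    h (show (f 0, f 1) ∈ synRect v by rw [← h']; exact hg)
  have key : ∀ D : Set (Site 2), synCount (insert f D) v = synCount D v ∧
      synCount (D \ {f}) v = synCount D v := by
    intro D
    unfold synCount
    rw [Finset.card_filter, Finset.card_filter, Finset.card_filter]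
    refine ⟨Finset.sum_congr rfl fun g hg' => ?_, Finset.sum_congr rfl fun g hg' => ?_⟩ <;>
    · have hne : (![g.1, g.2] : Site 2) ≠ f := fun h' => hg g hg' ((vec_eq_iff g f).1 h')
      exact ite_one_zero_congr _ _ (by
        simp only [Set.mem_insert_iff, hne, false_or, Set.mem_sdiff_singleton, ne_eq,
          not_false_eq_true, and_true])
  cases b <;> simp only [gaugeColour_iff, force, Bool.false_eq_true, if_false, if_true,
    (key ω.2.2.1).1, (key ω.2.2.1).2]

/-- The colours of the two forced configurations differ exactly on the quadrant of `f`. [folklore] -/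
theorem gaugeColour_force_true_iff (f : Site 2) (ω : Bits) (v : Site 2) :
    gaugeColour (force f true ω) v ↔ Xor (v ∈ quadrant f) (gaugeColour (force f false ω) v) := by
  simp only [gaugeColour_iff, force, if_true, Bool.false_eq_true, if_false, synCount_insert_eq]
  by_cases h : v ∈ quadrant f
  · simp only [h, if_true, Nat.odd_add_one, xor_true, xor_xor_not_right]
  · simp only [h, if_false, add_zero, xor_false, id_eq]

/-! ## §C Half-plane recolourings are gauge symmetries -/

/-- The gauge flip: flip the column bits on `H₀` and the row bits on `H₁` (recolours the cell `v` iff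
`[v₀ ∈ H₀] ⊕ [v₁ ∈ H₁]`). [folklore] -/
def gaugeFlip (H₀ H₁ : Set ℤ) (ω : Bits) : Bits := (ω.1 ∆ H₀, ω.2.1 ∆ H₁, ω.2.2)

/-- The gauge flip is an involution. [folklore] -/
theorem gaugeFlip_gaugeFlip (H₀ H₁ : Set ℤ) (ω : Bits) : gaugeFlip H₀ H₁ (gaugeFlip H₀ H₁ ω) = ω := by
  simp only [gaugeFlip, symmDiff_symmDiff_cancel_right]

/-- The gauge flip recolours the cell `v` iff `[v₀ ∈ H₀] ⊕ [v₁ ∈ H₁]`. [folklore] -/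
theorem gaugeColour_gaugeFlip_iff (H₀ H₁ : Set ℤ) (ω : Bits) (v : Site 2) :
    gaugeColour (gaugeFlip H₀ H₁ ω) v ↔ Xor (Xor (v 0 ∈ H₀) (v 1 ∈ H₁)) (gaugeColour ω v) := by
  simp only [gaugeColour_iff, gaugeFlip, Set.mem_symmDiff]
  exact xor_flip_aux _ _ _ _ _

/-- Forcing a syndrome commutes with the gauge flip (they act on different factors). [folklore] -/
theorem force_gaugeFlip (f : Site 2) (b : Bool) (H₀ H₁ : Set ℤ) (ω : Bits) :
    force f b (gaugeFlip H₀ H₁ ω) = gaugeFlip H₀ H₁ (force f b ω) := rfl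

/-- `A ↦ A ∆ H` is measurable on `Set α`. [folklore] -/
theorem measurable_symmDiff_const {α : Type*} (H : Set α) : Measurable fun A : Set α => A ∆ H := by
  refine measurable_set_iff.2 fun a => ?_
  by_cases ha : a ∈ H
  · simpa [Set.mem_symmDiff, ha] using measurable_set_notMem a
  · simpa [Set.mem_symmDiff, ha] using measurable_set_mem a

/-- The gauge flip is measurable. [folklore] -/
theorem measurable_gaugeFlip (H₀ H₁ : Set ℤ) : Measurable (gaugeFlip H₀ H₁) :=
  ((measurable_symmDiff_const H₀).comp measurable_fst).prodMk
    (((measurable_symmDiff_const H₁).comp (measurable_fst.comp measurable_snd)).prodMk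
      (measurable_snd.comp measurable_snd))

/-- The gauge flip as a measurable involution of the bit space. [folklore] -/
def gaugeFlipEquiv (H₀ H₁ : Set ℤ) : Bits ≃ᵐ Bits :=
  MeasurableEquiv.ofInvolutive (gaugeFlip H₀ H₁) (gaugeFlip_gaugeFlip H₀ H₁) (measurable_gaugeFlip H₀ H₁)

/-- FLIPPING A FIXED SET OF FAIR BITS IS MEASURE-PRESERVING: `A ↦ A ∆ H` preserves `setBer(univ, ½)`
(coordinatewise, `Not` preserves the fair Bernoulli law on `Prop`; cf. `sitePercolation_map_compl`,
the case `H = univ`). [folklore] -/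
theorem sitePercolation_half_map_symmDiff {V : Type*} (H : Set V) :
    (sitePercolation V half).map (fun A => A ∆ H) = sitePercolation V half := by
  have hsymm : unitInterval.symm half = half := by
    ext; simp [half]; norm_num
  have hxor : Measurable fun (χ : V → Prop) (v : V) => Xor (v ∈ H) (χ v) :=
    measurable_pi_lambda _ fun v => (Measurable.of_discrete (f := Xor (v ∈ H))).comp (measurable_pi_apply v)
  rw [Literature.Probability.Percolation.sitePercolation_eq_map,
    Measure.map_map (measurable_symmDiff_const H) measurable_setOf]
  have hcomp : ((fun A : Set V => A ∆ H) ∘ fun χ : V → Prop => {v | χ v}) =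
      (fun χ : V → Prop => {v | χ v}) ∘ fun χ v => Xor (v ∈ H) (χ v) := by
    funext χ; ext v
    simp only [Function.comp_apply, Set.mem_symmDiff, Set.mem_setOf_eq, Xor]
    tauto
  rw [hcomp, ← Measure.map_map measurable_setOf hxor]
  congr 1
  simp only [sitePi]
  rw [Measure.infinitePi_map_pi (fun _ : V => bernoulliProp half)
    (f := fun (v : V) (P : Prop) => Xor (v ∈ H) P) fun _ => Measurable.of_discrete]
  congr 1
  funext v
  by_cases hv : v ∈ H
  · have : (fun P : Prop => Xor (v ∈ H) P) = Not := by
      funext P; simp only [eq_iff_iff, Xor]; tauto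
    rw [this, Literature.Probability.Percolation.bernoulliProp_map_not, hsymm]
  · have : (fun P : Prop => Xor (v ∈ H) P) = id := by
      funext P; simp only [eq_iff_iff, Xor, id]; tauto
    rw [this, Measure.map_id]

/-- THE GAUGE FLIP PRESERVES THE CORNER-LINE MEASURE at every density `p` (it touches only the fair
column/row bits). [folklore] -/
theorem gaugeMeasure_map_gaugeFlip (p : ℝ) (H₀ H₁ : Set ℤ) :
    (gaugeMeasure p).map (gaugeFlip H₀ H₁) = gaugeMeasure p := by
  have h : gaugeFlip H₀ H₁ =
      Prod.map (fun A : Set ℤ => A ∆ H₀) (Prod.map (fun B : Set ℤ => B ∆ H₁) id) := by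
    funext ω; rfl
  rw [h, gaugeMeasure, ← Measure.map_prod_map _ _ (measurable_symmDiff_const H₀)
      ((measurable_symmDiff_const H₁).prodMap measurable_id),
    ← Measure.map_prod_map _ _ (measurable_symmDiff_const H₁) measurable_id, Measure.map_id,
    sitePercolation_half_map_symmDiff, sitePercolation_half_map_symmDiff]

/-- Applied form: `P_p(Φ⁻¹ T) = P_p(T)` for EVERY set `T` (measurable or not: `Φ` is a measurable
equivalence). [folklore] -/
theorem gaugeMeasure_preimage_gaugeFlip (p : ℝ) (H₀ H₁ : Set ℤ) (T : Set Bits) :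
    gaugeMeasure p (gaugeFlip H₀ H₁ ⁻¹' T) = gaugeMeasure p T := by
  have hcoe : ⇑(gaugeFlipEquiv H₀ H₁) = gaugeFlip H₀ H₁ := rfl
  rw [← hcoe, ← MeasurableEquiv.map_apply, hcoe, gaugeMeasure_map_gaugeFlip]

/-! ## §D The structural zeros of the influence -/

/-- `gaugeMeasure p` is a probability measure (product of five `setBer`'s). [folklore] -/
instance instIsProbabilityMeasureGaugeMeasure (p : ℝ) : IsProbabilityMeasure (gaugeMeasure p) := by
  unfold gaugeMeasure; infer_instance

/-- The trivial bound `|I_f(p)| ≤ 1` (a difference of two probabilities). [folklore] -/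
theorem abs_influence_le_one (p : ℝ) (R : ConformalRectangle) (δ : ℝ) (f : Site 2) :
    |influence p R δ f| ≤ 1 :=
  abs_sub_le_of_nonneg_of_le measureReal_nonneg measureReal_le_one measureReal_nonneg measureReal_le_one

/-- If on the window the quadrant of `f` is a "plaid" set `[v₀ ∈ H₀] ⊕ [v₁ ∈ H₁]`, forcing the syndrome ON
is forcing it OFF after the gauge flip: `force f true ⁻¹' A = Φ⁻¹' (force f false ⁻¹' A)`. [folklore] -/
theorem preimage_force_true_eq (R : ConformalRectangle) (δ : ℝ) (f : Site 2) (H₀ H₁ : Set ℤ)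
    (h : ∀ v ∈ window R δ, (v ∈ quadrant f ↔ Xor (v 0 ∈ H₀) (v 1 ∈ H₁))) :
    force f true ⁻¹' crossingEvent R δ = gaugeFlip H₀ H₁ ⁻¹' (force f false ⁻¹' crossingEvent R δ) := by
  ext ω
  simp only [Set.mem_preimage]
  refine mem_crossingEvent_congr_of_edges (mem_gaugeEdges_congr_of_colour (fun v hv => ?_) rfl)
  rw [gaugeColour_force_true_iff, force_gaugeFlip, gaugeColour_gaugeFlip_iff, h v hv]

/-- GAUGE-SYMMETRY ZERO (law level: "rays are pure gauge").  If on the lattice window of `R` the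
quadrant recoloured by the syndrome at `f` coincides with a plaid set `[v₀ ∈ H₀] ⊕ [v₁ ∈ H₁]` (e.g. a
half-plane, or nothing), then the signed influence of `f` vanishes EXACTLY, at every density `p` and
every mesh `δ`: the forcing is absorbed by the measure-preserving flip of the fair column bits on `H₀`
and row bits on `H₁`. [folklore] -/
theorem influence_eq_zero_of_quadrant_iff (p : ℝ) (R : ConformalRectangle) (δ : ℝ) (f : Site 2)
    (H₀ H₁ : Set ℤ) (h : ∀ v ∈ window R δ, (v ∈ quadrant f ↔ Xor (v 0 ∈ H₀) (v 1 ∈ H₁))) :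
    influence p R δ f = 0 := by
  unfold influence
  rw [preimage_force_true_eq R δ f H₀ H₁ h, sub_eq_zero, measureReal_def, measureReal_def,
    gaugeMeasure_preimage_gaugeFlip]

/-- ANCHOR (registered sub-goal of stmt-CriticalPhenomena-10964; vocabulary-only restatement of
`influence_eq_zero_of_quadrant_iff`).  GAUGE-SYMMETRY ZERO: if on the lattice window of `R` at mesh `δ` the set of
cells whose defect rectangle contains the face `f` is a plaid set `[v₀ ∈ H₀] ⊕ [v₁ ∈ H₁]`, then the signed influence
`I_f(p)` of the syndrome at `f` on the crude crossing event vanishes exactly, at every density `p`. [folklore] -/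
theorem influence_eq_zero_of_plaid : ∀ (p : ℝ) (R : ConformalRectangle) (δ : ℝ) (f : Site 2) (H₀ H₁ : Set ℤ), (∀ v : Site 2, (δ : ℂ) * (((v 0 : ℝ) : ℂ) + ((v 1 : ℝ) : ℂ) * Complex.I) ∈ R.carrier → ((f 0, f 1) ∈ Finset.Ico (min 0 (v 0)) (max 0 (v 0)) ×ˢ Finset.Ico (min 0 (v 1)) (max 0 (v 1)) ↔ Xor (v 0 ∈ H₀) (v 1 ∈ H₁))) → influence p R δ f = 0 := by
  intro p R δ f H₀ H₁ h
  exact influence_eq_zero_of_quadrant_iff p R δ f H₀ H₁ fun v hv => h v hv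

/-- A face whose quadrant misses the window does not move the event at all:
`force f b ⁻¹' A = A`. [folklore] -/
theorem preimage_force_eq_of_forall_notMem_quadrant {R : ConformalRectangle} {δ : ℝ} {f : Site 2}
    (h : ∀ v ∈ window R δ, v ∉ quadrant f) (b : Bool) :
    force f b ⁻¹' crossingEvent R δ = crossingEvent R δ := by
  ext ω
  exact mem_crossingEvent_congr_of_edges
    (mem_gaugeEdges_congr_of_colour (fun v hv => gaugeColour_force_iff_of_notMem_quadrant (h v hv) b ω) rfl)

/-- … hence has influence zero. [folklore] -/
theorem influence_eq_zero_of_forall_notMem_quadrant (p : ℝ) {R : ConformalRectangle} {δ : ℝ}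
    {f : Site 2} (h : ∀ v ∈ window R δ, v ∉ quadrant f) : influence p R δ f = 0 := by
  unfold influence
  rw [preimage_force_eq_of_forall_notMem_quadrant h, preimage_force_eq_of_forall_notMem_quadrant h,
    sub_self]

/-- ROW ZERO: if the row line of `f` does not split the window (every window cell is on the far side of
`f₁`, or none is), the influence of `f` vanishes — in the first case the quadrant is the half-plane
`farSide f₀ × ℤ` on the window (absorbed by the column bits), in the second it misses the window. [folklore] -/
theorem influence_eq_zero_of_row (p : ℝ) (R : ConformalRectangle) (δ : ℝ) (f : Site 2)
    (h : (∀ v ∈ window R δ, v 1 ∈ farSide (f 1)) ∨ ∀ v ∈ window R δ, v 1 ∉ farSide (f 1)) :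
    influence p R δ f = 0 := by
  rcases h with h | h
  · refine influence_eq_zero_of_quadrant_iff p R δ f (farSide (f 0)) ∅ fun v hv => ?_
    rw [mem_quadrant_iff, Set.mem_empty_iff_false, xor_false_right]
    exact ⟨fun h' => h'.1, fun h' => ⟨h', h v hv⟩⟩
  · exact influence_eq_zero_of_forall_notMem_quadrant p fun v hv ht =>
      h v hv ((mem_quadrant_iff f v).1 ht).2

/-- COLUMN ZERO: the same with the column line of `f` (absorbed by the row bits). [folklore] -/
theorem influence_eq_zero_of_col (p : ℝ) (R : ConformalRectangle) (δ : ℝ) (f : Site 2)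
    (h : (∀ v ∈ window R δ, v 0 ∈ farSide (f 0)) ∨ ∀ v ∈ window R δ, v 0 ∉ farSide (f 0)) :
    influence p R δ f = 0 := by
  rcases h with h | h
  · refine influence_eq_zero_of_quadrant_iff p R δ f ∅ (farSide (f 1)) fun v hv => ?_
    rw [mem_quadrant_iff, Set.mem_empty_iff_false, xor_false, id_eq]
    exact ⟨fun h' => h'.2, fun h' => ⟨h v hv, h'⟩⟩
  · exact influence_eq_zero_of_forall_notMem_quadrant p fun v hv ht =>
      h v hv ((mem_quadrant_iff f v).1 ht).1

/-- The SPLITTING FACES of `R` at mesh `δ`: the faces `f` whose column line AND row line both split the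
lattice window (window cells on both sides of each).  Only these — the dislocations genuinely inside the
window's shadow, `≍ δ⁻²` of them — can have non-zero influence. [folklore] -/
def splittingFaces (R : ConformalRectangle) (δ : ℝ) : Set (Site 2) :=
  {f | ((∃ v ∈ window R δ, v 0 ∈ farSide (f 0)) ∧ ∃ v ∈ window R δ, v 0 ∉ farSide (f 0)) ∧
    (∃ v ∈ window R δ, v 1 ∈ farSide (f 1)) ∧ ∃ v ∈ window R δ, v 1 ∉ farSide (f 1)}

/-- SUPPORT OF THE INFLUENCE: a face with non-zero influence is a splitting face. [folklore] -/
theorem mem_splittingFaces_of_influence_ne_zero {p : ℝ} {R : ConformalRectangle} {δ : ℝ} {f : Site 2}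
    (h : influence p R δ f ≠ 0) : f ∈ splittingFaces R δ := by
  by_contra hs
  apply h
  rcases not_and_or.1 hs with hs | hs <;> rcases not_and_or.1 hs with hs | hs
  · exact influence_eq_zero_of_col p R δ f (Or.inr fun v hv hf => hs ⟨v, hv, hf⟩)
  · exact influence_eq_zero_of_col p R δ f (Or.inl fun v hv => by_contra fun hf => hs ⟨v, hv, hf⟩)
  · exact influence_eq_zero_of_row p R δ f (Or.inr fun v hv hf => hs ⟨v, hv, hf⟩)
  · exact influence_eq_zero_of_row p R δ f (Or.inl fun v hv => by_contra fun hf => hs ⟨v, hv, hf⟩)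

/-- The support of `f ↦ I_f(p)` lies in the splitting faces. [folklore] -/
theorem support_influence_subset (p : ℝ) (R : ConformalRectangle) (δ : ℝ) :
    Function.support (influence p R δ) ⊆ splittingFaces R δ :=
  fun _ hf => mem_splittingFaces_of_influence_ne_zero hf

/-- REDUCTION OF THE RUSSO SUM TO THE SPLITTING FACES: `Σ_f |I_f| = Σ_{f splitting} |I_f|`. [folklore] -/
theorem influenceSum_eq_finsum_splittingFaces (p : ℝ) (R : ConformalRectangle) (δ : ℝ) :
    influenceSum p R δ =
      ∑ᶠ f : Site 2, if f ∈ splittingFaces R δ then |influence p R δ f| else 0 := by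
  unfold influenceSum
  refine finsum_congr fun f => ?_
  split_ifs with hs
  · rfl
  · rw [abs_eq_zero]; by_contra h; exact hs (mem_splittingFaces_of_influence_ne_zero h)

end Summit.CriticalPhenomena.CardyFormulaZ2.Theorems.CornerLineDescent.SymmetricSeed
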